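import Summits.QuantumAdvantage.QuantumAdvantage.Theorems.PurityDialLawE

/-! # PurityDialLawF — part 6/13 (mechanical split for landing of `PurityDialLaw`; content verbatim; scopes re-opened with their variables) -/

set_option linter.dupNamespace false
noncomputable section

namespace Summit.QuantumAdvantage.QuantumAdvantage.Theorems.PurityDialLaw
open Classical Finset Summit.QuantumAdvantage.AdviceFreeQNC0
open Literature.Computability.MetaComplexity Literature.Computability.MetaComplexity.Smolensky
open Literature.Computability.Complexity (parityFn)

section Thin

variable {k r : ℕ}

/-- points of the level set in the fibre over the outside assignment `u` having block-parity `b`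
(block = the leading `k` coordinates, glued by `Fin.append`). -/
def fibrePart (f : (Fin (k + r) → Bool) → Bool) (u : Fin r → Bool) (b : Bool) : ℕ :=
  (univ.filter fun y : Fin k → Bool => f (Fin.append y u) = true ∧ parityFn k y = b).card

/-- the fibre support `s_u`. -/
def fibreCard (f : (Fin (k + r) → Bool) → Bool) (u : Fin r → Bool) : ℕ :=
  (univ.filter fun y : Fin k → Bool => f (Fin.append y u) = true).card

/-- Purity-dial helper `fibreCard_eq` (lens-4 g6 PurityDialLaw v12 twin; see the enclosing section docstring). -/
theorem fibreCard_eq (f : (Fin (k + r) → Bool) → Bool) (u : Fin r → Bool) :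
    fibreCard f u = fibrePart f u true + fibrePart f u false := by
  unfold fibreCard fibrePart
  rw [← card_union_of_disjoint]
  · congr 1; ext y; simp only [mem_union, mem_filter, mem_univ, true_and]; cases parityFn k y <;> simp
  · exact disjoint_filter.2 fun y _ h1 h2 => by rw [h1.2] at h2; exact Bool.noConfusion h2.2

/-- Purity-dial helper `wt_append` (lens-4 g6 PurityDialLaw v12 twin; see the enclosing section docstring). -/
theorem wt_append (y : Fin k → Bool) (u : Fin r → Bool) : wt (Fin.append y u) = wt y + wt u := by
  unfold wt
  rw [card_filter, card_filter, card_filter, Fin.sum_univ_add]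
  simp only [Fin.append_left, Fin.append_right]

/-- Purity-dial helper `parityFn_append` (lens-4 g6 PurityDialLaw v12 twin; see the enclosing section docstring). -/
theorem parityFn_append (y : Fin k → Bool) (u : Fin r → Bool) :
    parityFn (k + r) (Fin.append y u) = xor (parityFn k y) (parityFn r u) := by
  rw [parityFn_eq_decide_wt, parityFn_eq_decide_wt, parityFn_eq_decide_wt, wt_append,
    show (wt y + wt u) % 2 = (wt y % 2 + wt u % 2) % 2 by omega]
  rcases Nat.mod_two_eq_zero_or_one (wt y) with h1 | h1 <;>
    rcases Nat.mod_two_eq_zero_or_one (wt u) with h2 | h2 <;> simp [h1, h2]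

/-- the parts of the level set, fibred over the outside assignments. -/
theorem card_part_eq_sum_fibre (f : (Fin (k + r) → Bool) → Bool) (b : Bool) :
    (univ.filter fun z : Fin (k + r) → Bool => f z = true ∧ parityFn (k + r) z = b).card =
      ∑ u : Fin r → Bool, fibrePart f u (xor b (parityFn r u)) := by
  rw [card_filter,
    ← Fintype.sum_equiv (Fin.appendEquiv k r)
      (fun x => if f (Fin.appendEquiv k r x) = true ∧ parityFn (k + r) (Fin.appendEquiv k r x) = b then 1 else 0)
      (fun z => if f z = true ∧ parityFn (k + r) z = b then 1 else 0) (fun _ => rfl),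
    Fintype.sum_prod_type_right]
  refine Finset.sum_congr rfl fun u _ => ?_
  unfold fibrePart
  rw [card_filter]
  refine Finset.sum_congr rfl fun y _ => ?_
  change (if f (Fin.append y u) = true ∧ parityFn (k + r) (Fin.append y u) = b then 1 else 0) =
    (if f (Fin.append y u) = true ∧ parityFn k y = xor b (parityFn r u) then 1 else 0)
  rw [parityFn_append]
  cases parityFn k y <;> cases parityFn r u <;> cases b <;> simp

/-- the restriction of a degree-`d` indicator to a fibre of the leading `k`-block has degree `≤ d` on the `k`-cube. -/
theorem fibre_mem_lowDeg (p : ℕ) [Fact p.Prime] {d : ℕ} {f : (Fin (k + r) → Bool) → Bool} (hf : HasDegF p f d)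
    (u : Fin r → Bool) :
    (fun y : Fin k → Bool => if f (Fin.append y u) = true then (1 : ZMod p) else 0) ∈ lowDeg (ZMod p) k d := by
  have hcoord : ∀ i : Fin (k + r),
      (fun y : Fin k → Bool => if Fin.append y u i = true then (1 : ZMod p) else 0) ∈ lowDeg (ZMod p) k 1 := by
    intro i
    induction i using Fin.addCases with
    | left j =>
      have : (fun y : Fin k → Bool => if Fin.append y u (Fin.castAdd r j) = true then (1 : ZMod p) else 0) =
          mono (ZMod p) ({j} : Finset (Fin k)) := by
        funext y; rw [Fin.append_left, mono_apply]; simp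
      rw [this]; exact mono_mem_lowDeg (by simp)
    | right j =>
      by_cases hu : u j = true
      · have : (fun y : Fin k → Bool => if Fin.append y u (Fin.natAdd k j) = true then (1 : ZMod p) else 0) = 1 := by
          funext y; rw [Fin.append_right, if_pos hu]; rfl
        rw [this]; exact one_mem_lowDeg 1
      · have : (fun y : Fin k → Bool => if Fin.append y u (Fin.natAdd k j) = true then (1 : ZMod p) else 0) = 0 := by
          funext y; rw [Fin.append_right, if_neg hu]; rfl
        rw [this]; exact Submodule.zero_mem _
  exact Smolensky.comp_mem_lowDeg_of_coord (fun y : Fin k → Bool => Fin.append y u) hcoord hf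

/-- **FIBRE CANCELLATION mod `p`.**  On every fibre of a block of `k > d` coordinates, the even and odd parts of a
degree-`d` level set agree modulo `p`. -/
theorem fibrePart_modEq (p : ℕ) [Fact p.Prime] {d : ℕ} (hd : d < k) {f : (Fin (k + r) → Bool) → Bool}
    (hf : HasDegF p f d) (u : Fin r → Bool) :
    (fibrePart f u false : ZMod p) = (fibrePart f u true : ZMod p) := by
  have h0 := Summit.QuantumAdvantage.QuantumAdvantage.Theorems.PairFreezing.altSum_eq_zero p hd (fibre_mem_lowDeg p hf u)
  have hsplit : ∑ y : Fin k → Bool, (if parityFn k y = true then (-1 : ZMod p) else 1) *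
      (fun y : Fin k → Bool => if f (Fin.append y u) = true then (1 : ZMod p) else 0) y =
      (fibrePart f u false : ZMod p) - (fibrePart f u true : ZMod p) := by
    unfold fibrePart
    rw [card_filter, card_filter]
    push_cast
    rw [← Finset.sum_sub_distrib]
    refine Finset.sum_congr rfl fun y _ => ?_
    cases parityFn k y <;> cases f (Fin.append y u) <;> simp
  rw [hsplit] at h0
  exact sub_eq_zero.1 h0

/-- hence a THIN fibre (fewer than `p` points of the level set) is EXACTLY parity-balanced. -/
theorem fibrePart_eq_of_thin (p : ℕ) [Fact p.Prime] {d : ℕ} (hd : d < k) {f : (Fin (k + r) → Bool) → Bool}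
    (hf : HasDegF p f d) {u : Fin r → Bool} (hu : fibreCard f u < p) :
    fibrePart f u false = fibrePart f u true := by
  have h := fibrePart_modEq p hd hf u
  rw [ZMod.natCast_eq_natCast_iff'] at h
  have hs := fibreCard_eq f u
  rwa [Nat.mod_eq_of_lt (by omega), Nat.mod_eq_of_lt (by omega)] at h

/-- **GLOBAL CANCELLATION.**  The parity imbalance of a degree-`d` level set is at most its mass in the `p`-HEAVY
fibres of the leading block of `k > d` coordinates — no hypothesis on the dimension. -/
theorem parts_sub_le_heavy (p : ℕ) [Fact p.Prime] {d : ℕ} (hd : d < k) {f : (Fin (k + r) → Bool) → Bool}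
    (hf : HasDegF p f d) :
    (oddPart f).card ≤ (evenPart f).card + ∑ u : Fin r → Bool, (if p ≤ fibreCard f u then fibreCard f u else 0) ∧
    (evenPart f).card ≤ (oddPart f).card + ∑ u : Fin r → Bool, (if p ≤ fibreCard f u then fibreCard f u else 0) := by
  have hper : ∀ (u : Fin r → Bool) (b : Bool),
      fibrePart f u b ≤ fibrePart f u (!b) + (if p ≤ fibreCard f u then fibreCard f u else 0) := by
    intro u b
    by_cases hu : p ≤ fibreCard f u
    · rw [if_pos hu, fibreCard_eq]
      cases b <;> simp only [Bool.not_false, Bool.not_true] <;> omega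
    · rw [if_neg hu, add_zero]
      have := fibrePart_eq_of_thin p hd hf (not_le.1 hu)
      cases b <;> simp only [Bool.not_false, Bool.not_true] <;> omega
  unfold oddPart evenPart
  rw [card_part_eq_sum_fibre, card_part_eq_sum_fibre, ← Finset.sum_add_distrib, ← Finset.sum_add_distrib]
  constructor
  · refine Finset.sum_le_sum fun u _ => ?_
    cases hq : parityFn r u
    · simpa using hper u true
    · simpa using hper u false
  · refine Finset.sum_le_sum fun u _ => ?_
    cases hq : parityFn r u
    · simpa using hper u false
    · simpa using hper u true

/-- **LOCAL THINNESS ⇒ BALANCE (PROVED).**  If at most half of a degree-`d` level set lies in `p`-heavy fibres of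
the leading block of `k > d` coordinates, the level set is `3`-balanced — at ANY dimension. -/
theorem relBal_three_of_thin (p : ℕ) [Fact p.Prime] {d : ℕ} (hd : d < k) {f : (Fin (k + r) → Bool) → Bool}
    (hf : HasDegF p f d)
    (hthin : 2 * ∑ u : Fin r → Bool, (if p ≤ fibreCard f u then fibreCard f u else 0) ≤
      (univ.filter fun z : Fin (k + r) → Bool => f z = true).card) : RelBal 3 f := by
  obtain ⟨h1, h2⟩ := parts_sub_le_heavy p hd hf
  rw [card_level_eq] at hthin
  unfold RelBal
  constructor <;> omega

end Thin

section SmallDegree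

variable {k r : ℕ}

/-- a fibre part is at most the block-parity class of the `k`-cube: `fibrePart f u b ≤ 2^{k-1}` (`k ≥ 1`). -/
theorem fibrePart_le_pow (hk : 1 ≤ k) (f : (Fin (k + r) → Bool) → Bool) (u : Fin r → Bool) (b : Bool) :
    fibrePart f u b ≤ 2 ^ (k - 1) := by
  unfold fibrePart
  rw [← Summit.QuantumAdvantage.QuantumAdvantage.Theorems.PairFreezing.Pairing.card_filter_parityFn k hk b]
  exact card_le_card fun y hy => by
    rw [mem_filter] at hy ⊢
    exact ⟨hy.1, hy.2.2⟩

/-- **SMALL DEGREE IS EXACTLY BALANCED, fibrewise (PROVED).**  If `2^{k-1} < p` then on EVERY fibre of the leading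
`k`-block (`k > d`) the even and odd parts of a degree-`d` level set are EQUAL: both are `≤ 2^{k-1} < p` and they agree
mod `p` (`fibrePart_modEq`). -/
theorem fibrePart_eq_of_pow_lt (p : ℕ) [Fact p.Prime] {d : ℕ} (hd : d < k) (hk : 2 ^ (k - 1) < p)
    {f : (Fin (k + r) → Bool) → Bool} (hf : HasDegF p f d) (u : Fin r → Bool) :
    fibrePart f u false = fibrePart f u true := by
  have h := fibrePart_modEq p hd hf u
  rw [ZMod.natCast_eq_natCast_iff'] at h
  have h1 := fibrePart_le_pow (r := r) (by omega) f u false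
  have h2 := fibrePart_le_pow (r := r) (by omega) f u true
  rwa [Nat.mod_eq_of_lt (by omega), Nat.mod_eq_of_lt (by omega)] at h

/-- **SMALL DEGREE IS EXACTLY BALANCED (PROVED): for `p > 2^{k-1}`, `k > d`, every `𝔽_p`-degree-`d` Boolean
function on `k + r` bits has `#odd = #even` EXACTLY** — in particular (`k = d + 1`) for every prime `p > 2^d` and
every `m ≥ d + 1`, with no threshold in `m` at all: the bottom of the dial (`d < log₂ p`) is decided exactly. -/
theorem parts_eq_of_pow_lt (p : ℕ) [Fact p.Prime] {d : ℕ} (hd : d < k) (hk : 2 ^ (k - 1) < p)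
    {f : (Fin (k + r) → Bool) → Bool} (hf : HasDegF p f d) : (oddPart f).card = (evenPart f).card := by
  unfold oddPart evenPart
  rw [card_part_eq_sum_fibre f true, card_part_eq_sum_fibre f false]
  refine Finset.sum_congr rfl fun u _ => ?_
  have h := fibrePart_eq_of_pow_lt p hd hk hf u
  rcases Bool.eq_false_or_eq_true (parityFn r u) with hu | hu <;> rw [hu]
  · exact h
  · exact h.symm

/-- hence `1`-balanced (a fortiori `3`-balanced). -/
theorem relBal_one_of_pow_lt (p : ℕ) [Fact p.Prime] {d : ℕ} (hd : d < k) (hk : 2 ^ (k - 1) < p)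
    {f : (Fin (k + r) → Bool) → Bool} (hf : HasDegF p f d) : RelBal 1 f := by
  have h := parts_eq_of_pow_lt p hd hk hf
  unfold RelBal
  constructor <;> omega

end SmallDegree

section AnyBlock

variable {m : ℕ}

/-- relabelling the coordinates by a permutation `σ`. -/
def permFn (σ : Equiv.Perm (Fin m)) (f : (Fin m → Bool) → Bool) : (Fin m → Bool) → Bool :=
  fun z => f (fun i => z (σ i))

/-- precomposition with `σ` as a bijection of the cube. -/
def precomp (σ : Equiv.Perm (Fin m)) : (Fin m → Bool) ≃ (Fin m → Bool) where
  toFun z := fun i => z (σ i)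
  invFun z := fun i => z (σ.symm i)
  left_inv z := by funext i; simp
  right_inv z := by funext i; simp

/-- Purity-dial helper `wt_comp_perm` (lens-4 g6 PurityDialLaw v12 twin; see the enclosing section docstring). -/
theorem wt_comp_perm (σ : Equiv.Perm (Fin m)) (z : Fin m → Bool) : wt (fun i => z (σ i)) = wt z := by
  unfold wt
  rw [card_filter, card_filter]
  exact Equiv.sum_comp σ (fun i => if z i = true then 1 else 0)

/-- Purity-dial helper `parityFn_comp_perm` (lens-4 g6 PurityDialLaw v12 twin; see the enclosing section docstring). -/
theorem parityFn_comp_perm (σ : Equiv.Perm (Fin m)) (z : Fin m → Bool) :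
    parityFn m (fun i => z (σ i)) = parityFn m z := by
  rw [parityFn_eq_decide_wt, parityFn_eq_decide_wt, wt_comp_perm]

/-- degree is invariant under relabelling. -/
theorem hasDegF_permFn (p : ℕ) [Fact p.Prime] (σ : Equiv.Perm (Fin m)) {f : (Fin m → Bool) → Bool} {d : ℕ}
    (hf : HasDegF p f d) : HasDegF p (permFn σ f) d := by
  have hcoord : ∀ i : Fin m,
      (fun z : Fin m → Bool => if (fun j => z (σ j)) i = true then (1 : ZMod p) else 0) ∈ lowDeg (ZMod p) m 1 := by
    intro i
    have : (fun z : Fin m → Bool => if (fun j => z (σ j)) i = true then (1 : ZMod p) else 0) =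
        mono (ZMod p) ({σ i} : Finset (Fin m)) := by
      funext z; rw [mono_apply]; simp
    rw [this]; exact mono_mem_lowDeg (by simp)
  exact Smolensky.comp_mem_lowDeg_of_coord (fun z : Fin m → Bool => fun j => z (σ j)) hcoord hf

/-- the parts are invariant under relabelling (a parity-preserving bijection of the cube). -/
theorem card_part_permFn (σ : Equiv.Perm (Fin m)) (f : (Fin m → Bool) → Bool) (b : Bool) :
    (univ.filter fun z : Fin m → Bool => permFn σ f z = true ∧ parityFn m z = b).card =
    (univ.filter fun z : Fin m → Bool => f z = true ∧ parityFn m z = b).card := by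
  rw [card_filter, card_filter,
    ← Equiv.sum_comp (precomp σ) (fun z : Fin m → Bool => if f z = true ∧ parityFn m z = b then 1 else 0)]
  refine Finset.sum_congr rfl fun z _ => ?_
  show (if f (fun i => z (σ i)) = true ∧ parityFn m z = b then 1 else 0) =
    (if f (fun i => z (σ i)) = true ∧ parityFn m (fun i => z (σ i)) = b then 1 else 0)
  rw [parityFn_comp_perm]

/-- Purity-dial helper `card_level_permFn` (lens-4 g6 PurityDialLaw v12 twin; see the enclosing section docstring). -/
theorem card_level_permFn (σ : Equiv.Perm (Fin m)) (f : (Fin m → Bool) → Bool) :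
    (univ.filter fun z : Fin m → Bool => permFn σ f z = true).card =
    (univ.filter fun z : Fin m → Bool => f z = true).card := by
  rw [card_level_eq, card_level_eq]
  unfold oddPart evenPart
  rw [card_part_permFn, card_part_permFn]

/-- Purity-dial helper `relBal_permFn_iff` (lens-4 g6 PurityDialLaw v12 twin; see the enclosing section docstring). -/
theorem relBal_permFn_iff (σ : Equiv.Perm (Fin m)) (f : (Fin m → Bool) → Bool) (R : ℕ) :
    RelBal R (permFn σ f) ↔ RelBal R f := by
  unfold RelBal oddPart evenPart
  rw [card_part_permFn, card_part_permFn]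

/-- **LOCAL THINNESS IN ANY BLOCK ⇒ BALANCE (PROVED).**  The block may be ANY `k`-set of coordinates `σ(leading k)`:
if at most half of the level set lies in `p`-heavy fibres of that block, the level set is `3`-balanced. -/
theorem relBal_three_of_thin_perm (p : ℕ) [Fact p.Prime] {k r d : ℕ} (hd : d < k)
    (σ : Equiv.Perm (Fin (k + r))) {f : (Fin (k + r) → Bool) → Bool} (hf : HasDegF p f d)
    (hthin : 2 * ∑ u : Fin r → Bool, (if p ≤ fibreCard (permFn σ f) u then fibreCard (permFn σ f) u else 0) ≤
      (univ.filter fun z : Fin (k + r) → Bool => f z = true).card) : RelBal 3 f := by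
  rw [← card_level_permFn σ f] at hthin
  exact (relBal_permFn_iff σ f 3).1 (relBal_three_of_thin p hd (hasDegF_permFn p σ hf) hthin)

/-- and exact balance in any block for small degree. -/
theorem parts_eq_of_pow_lt_perm (p : ℕ) [Fact p.Prime] {k r d : ℕ} (hd : d < k) (hk : 2 ^ (k - 1) < p)
    (σ : Equiv.Perm (Fin (k + r))) {f : (Fin (k + r) → Bool) → Bool} (hf : HasDegF p f d) :
    (oddPart f).card = (evenPart f).card := by
  have h := parts_eq_of_pow_lt p hd hk (hasDegF_permFn p σ hf)
  unfold oddPart evenPart at h ⊢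
  rwa [card_part_permFn, card_part_permFn] at h

end AnyBlock

section ThickNormalForm

/-- the pure-degree consequence: an unbalanced degree-`d` level set on `≥ d + 1` bits has `2^d ≥ p`, i.e. degree
`d ≥ log₂ p` (else it is exactly balanced, `parts_eq_of_pow_lt`). -/
theorem prime_le_pow_of_not_relBal {p : ℕ} [Fact p.Prime] {r d : ℕ} {f : (Fin (d + 1 + r) → Bool) → Bool}
    (hf : HasDegF p f d) (h : ¬ RelBal 3 f) : p ≤ 2 ^ d := by
  by_contra hlt
  have hk : 2 ^ (d + 1 - 1) < p := by rw [Nat.add_sub_cancel]; exact not_le.1 hlt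
  exact h (relBal_mono (by norm_num) (relBal_one_of_pow_lt p (Nat.lt_succ_self d) hk hf))

/-- from the WINDOW normal form (§15) to LOCAL THICKNESS IN EVERY BLOCK — generic in the source of the normal form:
instantiate the window form at `(max B 1, max A 1)` so that `m ≥ d + 1`, write `m = (d+1) + r`, read off
`p ≤ 2^d` (`prime_le_pow_of_not_relBal`) and apply `relBal_three_of_thin_perm` to every relabelling `σ`. -/
theorem normalForm_thick_of {p : ℕ} [Fact p.Prime]
    (hall : ∀ B A : ℕ, ∃ (m d : ℕ) (f : (Fin m → Bool) → Bool),
      A * (d + 1) ^ B ≤ m ∧ m < (d + 1) ^ 2 * 4 ^ (d + 1) ∧ HasDegF p f d ∧ ¬ RelBal 3 f ∧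
      (oddPart f).Nonempty ∧ (evenPart f).Nonempty) (B A : ℕ) :
    ∃ (r d : ℕ) (f : (Fin (d + 1 + r) → Bool) → Bool),
      A * (d + 1) ^ B ≤ d + 1 + r ∧ d + 1 + r < (d + 1) ^ 2 * 4 ^ (d + 1) ∧ HasDegF p f d ∧ ¬ RelBal 3 f ∧
      (oddPart f).Nonempty ∧ (evenPart f).Nonempty ∧ p ≤ 2 ^ d ∧
      ∀ σ : Equiv.Perm (Fin (d + 1 + r)),
        (univ.filter fun z : Fin (d + 1 + r) → Bool => f z = true).card <
          2 * ∑ u : Fin r → Bool, (if p ≤ fibreCard (permFn σ f) u then fibreCard (permFn σ f) u else 0) := by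
  obtain ⟨m, d, f, h1, h2, h3, h4, h5, h6⟩ := hall (max B 1) (max A 1)
  have hpow : (d + 1) ^ B ≤ (d + 1) ^ max B 1 := Nat.pow_le_pow_right (Nat.succ_pos d) (le_max_left _ _)
  have hpow1 : d + 1 ≤ (d + 1) ^ max B 1 := by
    calc d + 1 = (d + 1) ^ 1 := (pow_one _).symm
      _ ≤ (d + 1) ^ max B 1 := Nat.pow_le_pow_right (Nat.succ_pos d) (le_max_right _ _)
  have hA : A * (d + 1) ^ B ≤ m :=
    le_trans (Nat.mul_le_mul (le_max_left A 1) hpow) h1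
  have hdm : d + 1 ≤ m := by
    have : 1 * (d + 1) ^ max B 1 ≤ max A 1 * (d + 1) ^ max B 1 := Nat.mul_le_mul (le_max_right A 1) le_rfl
    omega
  obtain ⟨r, rfl⟩ : ∃ r, m = d + 1 + r := ⟨m - (d + 1), by omega⟩
  refine ⟨r, d, f, hA, h2, h3, h4, h5, h6, prime_le_pow_of_not_relBal h3 h4, fun σ => ?_⟩
  by_contra hge
  exact h4 (relBal_three_of_thin_perm p (Nat.lt_succ_self d) σ h3 (not_lt.1 hge))



/-- **NORMAL FORM, sharpened (law level, PROVED): a minimal counterexample to the dialed law has degree `≥ log₂ p`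
and is LOCALLY THICK IN EVERY `(d+1)`-BLOCK.** -/
theorem normalForm_thick_law (h : ¬ ∀ (p : ℕ) [Fact p.Prime], 5 ≤ p → ∃ B : ℕ, RelSmolLaw p 3 B) :
    ∃ (p : ℕ) (_ : Fact p.Prime), 5 ≤ p ∧ ∀ B A : ℕ, ∃ (r d : ℕ) (f : (Fin (d + 1 + r) → Bool) → Bool),
      A * (d + 1) ^ B ≤ d + 1 + r ∧ d + 1 + r < (d + 1) ^ 2 * 4 ^ (d + 1) ∧ HasDegF p f d ∧ ¬ RelBal 3 f ∧
      (oddPart f).Nonempty ∧ (evenPart f).Nonempty ∧ p ≤ 2 ^ d ∧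
      ∀ σ : Equiv.Perm (Fin (d + 1 + r)),
        (univ.filter fun z : Fin (d + 1 + r) → Bool => f z = true).card <
          2 * ∑ u : Fin r → Bool, (if p ≤ fibreCard (permFn σ f) u then fibreCard (permFn σ f) u else 0) := by
  obtain ⟨p, hP, hp, hall⟩ := normalForm_of_not_relSmolPoly h
  exact ⟨p, hP, hp, fun B A => normalForm_thick_of hall B A⟩

end ThickNormalForm


/-! ### §20 TENSOR CLOSURE: block products of weight-determined functions obey the polynomial law (`B = 4`)

The census' candidate counterexamples to the `∃B` law were TENSOR POWERS of residue readers (relative bias MULTIPLIES over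
disjoint blocks).  This section PROVES that the whole tensor closure of the weight-determined class — conjunctions
`g₁(wt of block 1) ∧ … ∧ g_t(wt of block t)` over ANY partition of the coordinates into blocks, in any order — satisfies the
dialed law `RelSmolLaw p 3 4` with the explicit constant `A = 2p²(p+3) + 1`.  Mechanism (all PROVED):
* `tensor g h` (conjunction on disjoint blocks): the parity parts obey `O = E_g·O_h + O_g·E_h`, `E = O_g·O_h + E_g·E_h`
  (`card_oddPart_tensor`, `card_evenPart_tensor`), so ONE `R`-balanced factor makes the tensor `R`-balanced
  (`relBal_tensor_left/right`) — bias multiplies, it never grows;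
* RESTRICTION: each factor of a satisfiable tensor has degree `≤` the tensor's (`hasDegF_tensor_left/right`, fibre restriction);
* DEGREE CERTIFICATE: `ANDCert t f` — `f` contains a literal copy of `AND_t` — forces `t ≤ deg f` (`le_of_andCert`: the
  alternating sum of `AND_t` on the `t`-cube is `±1 ≠ 0`, against `Summit.QuantumAdvantage.QuantumAdvantage.Theorems.PairFreezing.altSum_eq_zero`); a non-constant function has `ANDCert 1`
  (a SENSITIVE EDGE, `exists_sensitive`), certificates tensor (`andCert_tensor`);
* FREE COORDINATE ⇒ exact balance (`parts_eq_of_free`);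
* the INVARIANT `BlockInv p f := ∀ d, HasDegF p f d → RelBal 3 f ∨ ∃ t, ANDCert t f ∧ m + t ≤ t · T_p(d)` with the symmetric
  threshold `T_p(d) = symThreshold p d = 2(p·max d 1)²(log₂(p·max d 1) + 3)` of §17–§18: weight-determined functions satisfy it
  (`blockInv_of_wtDetermined`: past the threshold §18 balances them, below it they are constant or carry a sensitive edge), it is
  closed under tensor (`blockInv_tensor`), relabelling (`blockInv_permFn`) and input negation (`blockInv_negFn`), contains every
  junta on `< 2p²(log₂ p + 3)` bits (`blockInv_of_small`) and every DISJUNCTION over a non-trivial block split (`relBal_three_bor`: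
  `bor g h` is ALWAYS `3`-balanced, for arbitrary `g`, `h` — degree-free), and it IMPLIES THE LAW (and, independently,
  DENSE level sets — density `≥ 2^{-k}`, `m ≥ (d+1)²·4^{k+1}` — are `3`-balanced by absolute Smolensky alone: `relBal_three_of_dense`;
  and the CELL FORM `relBal_of_fibres` / `cell_mono` / `lawAt_iff_cells`: fibrewise `R`-balanced ⇒ `R`-balanced, so ONE certified cell
  `(p, d, m₀)` certifies all `m ≥ m₀` and every dial member is equivalent to its restriction to the cells `m = τ d`; and the first
  SPARSE ASYMMETRIC class: `relBal_three_ofForms` — every function `φ(ℓ_1, …, ℓ_K)` of `K` linear forms `mod p` (arbitrary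
  coefficients; cells of density `p^{-K}`) of degree `≤ d` on `m ≥ 2p²(d + 1 + K(log₂ p + 1))` bits is `3`-balanced — cell sign sums
  are `≤ (2cos(π/2p))^m` by the tree's two-moduli exponential sums (`TwoModuli.sum_cell_eq_sum_twisted`,
  `TwoModuli.norm_cubeSum_le_of_ne_zero` with `N = 2`) against DLSZ `#f ≥ 2^{m−d}`; `relSmolLaw_one_ofForms`: `B = 1` on the class;
  `relBal_three_ofForms_mod`: the same modulo ANY odd `q`, the degree prime `p` and the modulus DECOUPLED); and BLOCK-WEIGHT
  FUNCTIONS with an ARBITRARY combiner (`blockWtClass`, the census classifier's BLOCK-SYMMETRIC): `ofForms_of_blockWt` — degree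
  `≤ d < p^e` ⇒ a function of the `K` block weights `mod p^e` (§18 periodicity blockwise) — and `relBal_three_of_blockWt'`:
  `3`-balanced on `m ≥ 2(p·max d 1)²(d + 1 + K(log₂(p·max d 1) + 1))` bits, polynomial in `d`, linear in `K`, for EVERY combiner: `relBal_three_of_blockInv` (`d·T_p(d) < m`, since
  `t ≤ d`) and `relSmolLaw_four_of_blockInv` (`A(d+1)^4 ≤ m`, `A = 2p²(p+3)+1`).
So no block-product of symmetric pieces — in particular no tensor power of a residue reader, padded or not — refutes the residual
`RelSmolPolyOdd`; a counterexample must be INDECOMPOSABLE as well as asymmetric and locally thick. -/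


end Summit.QuantumAdvantage.QuantumAdvantage.Theorems.PurityDialLaw
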